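import Mathlib
import HarnessLib
import Summits.HubbardSuperconductivity.HubbardSuperconductivity.Theorems.KLProgrammeKLRegimeCountertermJacksonLowBernstein
import Summits.HubbardSuperconductivity.HubbardSuperconductivity.Theorems.KLProgrammeKLRegimeSplitFermiPointSmooth

/-!
# Route `KLProgramme`, crux K3 — child Counterterm («fixed point on FrameOK's tube»): the Jackson mean and the low part are
# COEFFICIENT-WEIGHT CONTRACTIONS on frames (`coeffNorm r (jacksonFrame d G.eval) ≤ coeffNorm r G`, same for `jlowFrame`; constant `1`, every `r`, no `d`-loss)

Seat hubbard-kl-k3c3-p2 (g6).  Consumer-side input for the two-leg-slot menu on the ENGINE item stmt-HubbardSuperconductivity-20236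
((ρ3) «position-moment laws for the frame pieces» / (R-A) «Wiener-normed (E3c)», HOME STATUS 2026-08-27 l.2296/l.2312–2313, CHILD2-GEN7-CONTRACT
§2/§5): child 2's frame map `K ↦ jlowFrame d (…)` (`…CountertermJacksonLowPart`) acts on the `TrigPolyC4v` coefficient table by the MULTIPLIERS
`ĵ_k ĵ_l (2 − ĵ_k ĵ_l)` with `ĵ_k := jkerCoeff d k · cosNorm k ∈ [0, 1]` (the normalised Fourier coefficients of the `2π`-periodic Jackson kernel:
an autocorrelation of the non-negative Fejér coefficients, of mass one), so EVERY coefficient weight `TrigPolyC4v.coeffNorm r` — in particular the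
Wiener norm `r = 0` and the position-moment laws `r ≤ 2` — is non-increasing under it, with constant `1` and no dependence on the degree `d`
(contrast `coeffNorm_jlowFrame_le`, the SUP-keyed Bessel route, which loses `(2d+1)(1+4d)ⁱ`).

* §1 `jkerCoeff_nonneg`, `jkerCoeff_eq_zero_of_lt`, `jhat_nonneg`, `jhat_le_one` (`0 ≤ ĵ_k ≤ 1`);
* §2 `symCoeff_symm`, `cosMoment_harmonic`, `cosMoment_trigPoly_eval` (the cosine moments of a frame ARE its symmetrised coefficients times `cosNorm k · cosNorm l`);
* §3 `jacksonFrame_eval_coeff`, **`coeffNorm_jacksonFrame_eval_le`**;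
* §4 `cosMoment_jsmooth_trigPoly_eval` (convolution theorem on frames), `jlowFrame_eval_coeff`, **`coeffNorm_jlowFrame_eval_le`**.

Pure real analysis on the landed Jackson files; nothing about the model; nothing here asserts superconductivity.
-/

noncomputable section

namespace Summit.HubbardSuperconductivity.HubbardSuperconductivity.Theorems.KLRegimeSplit

set_option linter.dupNamespace false -- summit = problem name (single-conjunct summit), D-0017

open Real Finset MeasureTheory intervalIntegral Literature.MathematicalPhysics.QuantumLattice

/-! ## §1 The normalised Jackson multipliers `ĵ_k ∈ [0, 1]` -/

/-! Throughout, the normalised Jackson multiplier is written out as `jkerCoeff d k * cosNorm k` (`= ∫_{−π}^{π} J̃_d(s) cos(k s) ds` for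
`k ≤ 2d`, `0` beyond; «`ĵ_k`» in the docstrings) and the symmetrised, degree-truncated coefficient of a frame `G` as
`if k ≤ G.degree ∧ l ≤ G.degree then (G.coeff k l + G.coeff l k) / 2 else 0` («`κ̃_{k,l}`»); no auxiliary definitions are introduced. -/

/-- The Fejér coefficients are non-negative up to the order. -/
theorem fejerCoeff_nonneg (d : ℕ) {h : ℕ} (hh : h ≤ d) : 0 ≤ fejerCoeff d h := by
  unfold fejerCoeff
  split_ifs
  · exact zero_le_one
  · have : (h : ℝ) ≤ d := by exact_mod_cast hh
    apply div_nonneg (by linarith) (by positivity)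

/-- Product-to-sum coefficients of two non-negative coefficient sequences are non-negative. -/
theorem cosMulCoeff_nonneg {N N' : ℕ} {a b : ℕ → ℝ} (ha : ∀ k ≤ N, 0 ≤ a k) (hb : ∀ l ≤ N', 0 ≤ b l) (m : ℕ) :
    0 ≤ cosMulCoeff N N' a b m := by
  unfold cosMulCoeff
  refine Finset.sum_nonneg fun k hk => Finset.sum_nonneg fun l hl => ?_
  have hk' := ha k (by have := mem_range.mp hk; omega)
  have hl' := hb l (by have := mem_range.mp hl; omega)
  refine mul_nonneg (div_nonneg (mul_nonneg hk' hl') (by norm_num)) (add_nonneg ?_ ?_) <;> split_ifs <;> norm_num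

/-- **`ĵ_k ≥ 0`** at the level of `jkerCoeff`: the Jackson kernel is a normalised Fejér SQUARE, so its cosine coefficients are autocorrelations of
non-negative numbers divided by a positive constant. -/
theorem jkerCoeff_nonneg (d k : ℕ) : 0 ≤ jkerCoeff d k := by
  unfold jkerCoeff
  refine div_nonneg (cosMulCoeff_nonneg (fun h hh => fejerCoeff_nonneg d hh) (fun h hh => fejerCoeff_nonneg d hh) k) ?_
  have hc := Literature.Analysis.Fourier.TrigApprox.jacksonConst_ge d
  have : (0 : ℝ) < 8 * (d + 1) / π ^ 4 := by positivity
  exact mul_nonneg (by linarith) (by positivity)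

/-- Beyond degree `2d` the Jackson coefficients vanish. -/
theorem jkerCoeff_eq_zero_of_lt (d : ℕ) {k : ℕ} (hk : d + d < k) : jkerCoeff d k = 0 := by
  unfold jkerCoeff cosMulCoeff
  rw [Finset.sum_eq_zero, zero_div]
  intro a ha
  refine Finset.sum_eq_zero fun b hb => ?_
  have ha' := mem_range.mp ha
  have hb' := mem_range.mp hb
  have h1 : ¬ (a + b = k) := by omega
  have h2 : ¬ (Int.natAbs ((a : ℤ) - b) = k) := by omega
  simp [h1, h2]

/-- **`0 ≤ ĵ_k`.** -/
theorem jhat_nonneg (d k : ℕ) : 0 ≤ (jkerCoeff d k * cosNorm k) := mul_nonneg (jkerCoeff_nonneg d k) (cosNorm_pos k).le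

/-- **`ĵ_k ≤ 1`** (`|∫ J̃_d cos(k·)| ≤ ∫ J̃_d = 1` for `k ≤ 2d`; `ĵ_k = 0` beyond). -/
theorem jhat_le_one (d k : ℕ) : (jkerCoeff d k * cosNorm k) ≤ 1 := by
  by_cases hk : k ≤ d + d
  · have h := abs_jkerCoeff_le d hk
    have hπ := Real.pi_pos
    have hcn := cosNorm_le k
    have hck := (cosNorm_pos k).le
    by_cases hk0 : k = 0
    · -- `ĵ_0 = ∫ J̃_d = 1`
      subst hk0
      have hint := integral_jker_mul_cos d (k := 0) (by omega)
      have h1 : ∫ s in (-π)..π, jker d s * Real.cos ((0 : ℕ) * s) = 1 := by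
        simp only [Nat.cast_zero, zero_mul, Real.cos_zero, mul_one]
        exact integral_jker d
      rw [h1] at hint
      exact le_of_eq hint.symm
    · have hcn' : cosNorm k = π := by unfold cosNorm; rw [if_neg hk0]
      rw [hcn']
      calc jkerCoeff d k * π ≤ |jkerCoeff d k| * π := by gcongr; exact le_abs_self _
        _ ≤ 1 / π * π := by gcongr
        _ = 1 := by field_simp
  · rw [jkerCoeff_eq_zero_of_lt d (by omega), zero_mul]
    exact zero_le_one

/-- `|ĵ_k| ≤ 1`. -/
theorem abs_jhat_le_one (d k : ℕ) : |(jkerCoeff d k * cosNorm k)| ≤ 1 := by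
  rw [abs_of_nonneg (jhat_nonneg d k)]; exact jhat_le_one d k

/-- The product multiplier `x = ĵ_k ĵ_l ∈ [0,1]`. -/
theorem jhat_mul_jhat_mem (d k l : ℕ) : 0 ≤ (jkerCoeff d k * cosNorm k) * (jkerCoeff d l * cosNorm l) ∧ (jkerCoeff d k * cosNorm k) * (jkerCoeff d l * cosNorm l) ≤ 1 :=
  ⟨mul_nonneg (jhat_nonneg d k) (jhat_nonneg d l),
    mul_le_one₀ (jhat_le_one d k) (jhat_nonneg d l) (jhat_le_one d l)⟩

/-! ## §2 Cosine moments of a frame -/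

/-- The symmetrised truncated coefficient `κ̃_{k,l}` is symmetric in `(k,l)`. -/
theorem symCoeff_symm (G : TrigPolyC4v) (k l : ℕ) :
    (if l ≤ G.degree ∧ k ≤ G.degree then (G.coeff l k + G.coeff k l) / 2 else 0) =
      (if k ≤ G.degree ∧ l ≤ G.degree then (G.coeff k l + G.coeff l k) / 2 else 0) := by
  by_cases h : k ≤ G.degree ∧ l ≤ G.degree
  · rw [if_pos h, if_pos ⟨h.2, h.1⟩]; ring
  · rw [if_neg h, if_neg (fun h' => h ⟨h'.2, h'.1⟩)]

/-- `|κ̃_{k,l}| ≤ ½(|κ_{k,l}| + |κ_{l,k}|)` inside the degree, `0` outside. -/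
theorem abs_symCoeff_le (G : TrigPolyC4v) (k l : ℕ) :
    |(if k ≤ G.degree ∧ l ≤ G.degree then (G.coeff k l + G.coeff l k) / 2 else 0)| ≤
      if k ≤ G.degree ∧ l ≤ G.degree then (|G.coeff k l| + |G.coeff l k|) / 2 else 0 := by
  split_ifs
  · rw [abs_div, abs_two]
    gcongr
    exact abs_add_le _ _
  · simp

/-- The harmonic `h_{m,n}` read on `ℝ × ℝ` is `½(e_{mn} + e_{nm})`. -/
theorem harmonic_eq_cosProd (m n : ℕ) (w : ℝ × ℝ) :
    TrigPolyC4v.harmonic m n ![w.1, w.2] = (cosProd m n w + cosProd n m w) / 2 := by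
  simp [TrigPolyC4v.harmonic, cosProd]

/-- The harmonics are continuous. -/
theorem continuous_harmonic' (m n : ℕ) : Continuous (TrigPolyC4v.harmonic m n) := by
  unfold TrigPolyC4v.harmonic; fun_prop

/-- **Cosine moments of a harmonic** (orthogonality): `A_{h_{mn}}(k,l) = ½([k=m][l=n] + [k=n][l=m])·cosNorm k·cosNorm l`. -/
theorem cosMoment_harmonic (m n k l : ℕ) :
    cosMoment (TrigPolyC4v.harmonic m n) k l =
      ((if k = m then cosNorm k else 0) * (if l = n then cosNorm l else 0) +
        (if k = n then cosNorm k else 0) * (if l = m then cosNorm l else 0)) / 2 := by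
  rw [cosMoment_eq_integral_prod (continuous_harmonic' m n)]
  have e : (fun w : ℝ × ℝ => cosProd k l w * TrigPolyC4v.harmonic m n ![w.1, w.2]) =
      fun w => (1 / 2 : ℝ) * (cosProd k l w * cosProd m n w) + (1 / 2 : ℝ) * (cosProd k l w * cosProd n m w) := by
    funext w; rw [harmonic_eq_cosProd]; ring
  have hi1 : Integrable (fun w => cosProd k l w * cosProd m n w) jmeas :=
    integrable_jmeas_of_continuous ((continuous_cosProd k l).mul (continuous_cosProd m n))
  have hi2 : Integrable (fun w => cosProd k l w * cosProd n m w) jmeas :=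
    integrable_jmeas_of_continuous ((continuous_cosProd k l).mul (continuous_cosProd n m))
  rw [e, integral_add (hi1.const_mul _) (hi2.const_mul _), MeasureTheory.integral_const_mul, MeasureTheory.integral_const_mul,
    integral_cosProd_mul_cosProd, integral_cosProd_mul_cosProd]
  ring

/-- **Cosine moments of a frame are its symmetrised coefficients**: `A_{G}(k,l) = cosNorm k · cosNorm l · κ̃_{k,l}`. -/
theorem cosMoment_trigPoly_eval (G : TrigPolyC4v) (k l : ℕ) :
    cosMoment G.eval k l =
      cosNorm k * cosNorm l * (if k ≤ G.degree ∧ l ≤ G.degree then (G.coeff k l + G.coeff l k) / 2 else 0) := by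
  have hG : Continuous G.eval := (TrigPolyC4v.contDiff_eval G (n := 0)).continuous
  rw [cosMoment_eq_integral_prod hG]
  -- expand the frame
  have e : (fun w : ℝ × ℝ => cosProd k l w * G.eval ![w.1, w.2]) =
      fun w => ∑ m ∈ range (G.degree + 1), ∑ n ∈ range (G.degree + 1),
        G.coeff m n * (cosProd k l w * TrigPolyC4v.harmonic m n ![w.1, w.2]) := by
    funext w
    rw [TrigPolyC4v.eval_def, Finset.mul_sum]
    refine Finset.sum_congr rfl fun m _ => ?_
    rw [Finset.mul_sum]
    exact Finset.sum_congr rfl fun n _ => by ring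
  have hint : ∀ m n, Integrable (fun w : ℝ × ℝ => cosProd k l w * TrigPolyC4v.harmonic m n ![w.1, w.2]) jmeas := by
    intro m n
    refine integrable_jmeas_of_continuous ((continuous_cosProd k l).mul ?_)
    refine (continuous_harmonic' m n).comp (continuous_pi fun i => ?_)
    fin_cases i <;> simp <;> fun_prop
  rw [e, integral_finsetSum _ (fun m _ => integrable_finsetSum _ fun n _ => (hint m n).const_mul _)]
  have hmom : ∀ m n, ∫ w, G.coeff m n * (cosProd k l w * TrigPolyC4v.harmonic m n ![w.1, w.2]) ∂jmeas =
      G.coeff m n * cosMoment (TrigPolyC4v.harmonic m n) k l := by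
    intro m n
    rw [MeasureTheory.integral_const_mul, cosMoment_eq_integral_prod (continuous_harmonic' m n) k l]
  have hstep : ∀ m ∈ range (G.degree + 1),
      ∫ w, ∑ n ∈ range (G.degree + 1), G.coeff m n * (cosProd k l w * TrigPolyC4v.harmonic m n ![w.1, w.2]) ∂jmeas =
        ∑ n ∈ range (G.degree + 1), G.coeff m n * cosMoment (TrigPolyC4v.harmonic m n) k l := by
    intro m _
    rw [integral_finsetSum _ (fun n _ => (hint m n).const_mul _)]
    exact Finset.sum_congr rfl fun n _ => hmom m n
  rw [Finset.sum_congr rfl hstep]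
  -- the summand as two Kronecker-delta products
  set R := range (G.degree + 1) with hR
  set N : ℝ := cosNorm k * cosNorm l with hN
  have hpt : ∀ m n : ℕ, G.coeff m n * cosMoment (TrigPolyC4v.harmonic m n) k l =
      (if k = m then (if l = n then G.coeff m n * N / 2 else 0) else 0) +
        (if l = m then (if k = n then G.coeff m n * N / 2 else 0) else 0) := by
    intro m n
    rw [cosMoment_harmonic, hN]
    split_ifs <;> ring
  rw [Finset.sum_congr rfl fun m _ => Finset.sum_congr rfl fun n _ => hpt m n]
  simp_rw [Finset.sum_add_distrib]
  -- evaluating a double delta sum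
  have hδ : ∀ (a b : ℕ) (g : ℕ → ℕ → ℝ),
      ∑ m ∈ R, ∑ n ∈ R, (if a = m then (if b = n then g m n else 0) else 0) =
        if a ≤ G.degree ∧ b ≤ G.degree then g a b else 0 := by
    intro a b g
    by_cases ha : a ≤ G.degree
    · have ham : a ∈ R := by rw [hR]; exact mem_range.mpr (by omega)
      rw [Finset.sum_eq_single_of_mem a ham (fun m _ hm =>
        Finset.sum_eq_zero fun n _ => if_neg (fun h : a = m => hm h.symm))]
      simp only [if_true]
      by_cases hb : b ≤ G.degree
      · have hbm : b ∈ R := by rw [hR]; exact mem_range.mpr (by omega)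
        rw [Finset.sum_eq_single_of_mem b hbm (fun n _ hn => if_neg (fun h : b = n => hn h.symm)), if_pos rfl, if_pos ⟨ha, hb⟩]
      · rw [if_neg (fun h => hb h.2)]
        refine Finset.sum_eq_zero fun n hn => if_neg (fun h : b = n => hb ?_)
        subst h; rw [hR] at hn; have := mem_range.mp hn; omega
    · rw [if_neg (fun h => ha h.1)]
      refine Finset.sum_eq_zero fun m hm => Finset.sum_eq_zero fun n _ => if_neg (fun h : a = m => ha ?_)
      subst h; rw [hR] at hm; have := mem_range.mp hm; omega
  rw [hδ k l (fun m n => G.coeff m n * N / 2), hδ l k (fun m n => G.coeff m n * N / 2)]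
  by_cases h : k ≤ G.degree ∧ l ≤ G.degree
  · rw [if_pos h, if_pos ⟨h.2, h.1⟩, if_pos h]; ring
  · rw [if_neg h, if_neg (fun h' => h ⟨h'.2, h'.1⟩), if_neg h]; ring

/-! ## §3 The Jackson mean of a frame: coefficients and the weight contraction -/

/-- **Coefficients of the Jackson mean of a frame**: `(jacksonFrame d G)_{k,l} = ĵ_k ĵ_l κ̃_{k,l}`. -/
theorem jacksonFrame_eval_coeff (d : ℕ) (G : TrigPolyC4v) (k l : ℕ) :
    (jacksonFrame d G.eval).coeff k l = (jkerCoeff d k * cosNorm k) * (jkerCoeff d l * cosNorm l) *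
      (if k ≤ G.degree ∧ l ≤ G.degree then (G.coeff k l + G.coeff l k) / 2 else 0) := by
  show jkerCoeff d k * jkerCoeff d l * cosMoment G.eval k l = _
  rw [cosMoment_trigPoly_eval]; ring

/-- A weighted symmetrised-coefficient sum over any square is bounded by the frame's coefficient weight:
`Σ_{k,l ≤ B} (1+k+l)^r |κ̃_{k,l}| ≤ coeffNorm r G`. -/
theorem sum_weight_abs_symCoeff_le (G : TrigPolyC4v) (r B : ℕ) :
    ∑ k ∈ range (B + 1), ∑ l ∈ range (B + 1),
      ((1 : ℝ) + k + l) ^ r * |(if k ≤ G.degree ∧ l ≤ G.degree then (G.coeff k l + G.coeff l k) / 2 else 0)| ≤ G.coeffNorm r := by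
  set D := G.degree with hD
  -- the truncated weight table of the frame
  set f : ℕ → ℕ → ℝ := fun k l => if k ≤ D ∧ l ≤ D then ((1 : ℝ) + k + l) ^ r * |G.coeff k l| else 0 with hf
  have hf0 : ∀ k l, 0 ≤ f k l := fun k l => by simp only [hf]; split_ifs <;> positivity
  -- (i) termwise: weight·|κ̃| ≤ ½ (f k l + f l k)
  have hterm : ∀ k l : ℕ,
      ((1 : ℝ) + k + l) ^ r * |(if k ≤ G.degree ∧ l ≤ G.degree then (G.coeff k l + G.coeff l k) / 2 else 0)| ≤ (f k l + f l k) / 2 := by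
    intro k l
    by_cases hkl : k ≤ G.degree ∧ l ≤ G.degree
    · have hlk : l ≤ D ∧ k ≤ D := ⟨hkl.2, hkl.1⟩
      simp only [hf, if_pos (show k ≤ D ∧ l ≤ D from hkl), if_pos hlk, if_pos hkl]
      have hw : ((1 : ℝ) + l + k) ^ r = ((1 : ℝ) + k + l) ^ r := by ring
      rw [hw, abs_div, abs_two]
      calc ((1 : ℝ) + k + l) ^ r * (|G.coeff k l + G.coeff l k| / 2)
          ≤ ((1 : ℝ) + k + l) ^ r * ((|G.coeff k l| + |G.coeff l k|) / 2) := by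
            gcongr; exact abs_add_le _ _
        _ = _ := by ring
    · rw [if_neg hkl, abs_zero, mul_zero]
      exact div_nonneg (add_nonneg (hf0 k l) (hf0 l k)) (by norm_num)
  -- (ii) the coefficient weight is the `f`-sum over its own square …
  have hcn : G.coeffNorm r = ∑ k ∈ range (D + 1), ∑ l ∈ range (D + 1), f k l := by
    rw [TrigPolyC4v.coeffNorm, ← hD]
    refine Finset.sum_congr rfl fun k hk => Finset.sum_congr rfl fun l hl => ?_
    have := mem_range.mp hk; have := mem_range.mp hl
    simp only [hf, if_pos (show k ≤ D ∧ l ≤ D by omega)]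
  -- … which dominates the `f`-sum over any square
  have hsq : ∑ k ∈ range (B + 1), ∑ l ∈ range (B + 1), f k l ≤ G.coeffNorm r := by
    rw [hcn]
    set T := max B D with hT
    have hBT : range (B + 1) ⊆ range (T + 1) := range_mono (by omega)
    have hDT : range (D + 1) ⊆ range (T + 1) := range_mono (by omega)
    have h1 : ∑ k ∈ range (B + 1), ∑ l ∈ range (B + 1), f k l ≤ ∑ k ∈ range (T + 1), ∑ l ∈ range (T + 1), f k l :=
      calc ∑ k ∈ range (B + 1), ∑ l ∈ range (B + 1), f k l ≤ ∑ k ∈ range (B + 1), ∑ l ∈ range (T + 1), f k l :=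
            Finset.sum_le_sum fun k _ => Finset.sum_le_sum_of_subset_of_nonneg hBT fun l _ _ => hf0 k l
        _ ≤ ∑ k ∈ range (T + 1), ∑ l ∈ range (T + 1), f k l :=
            Finset.sum_le_sum_of_subset_of_nonneg hBT fun k _ _ => Finset.sum_nonneg fun l _ => hf0 k l
    have h2 : ∑ k ∈ range (D + 1), ∑ l ∈ range (D + 1), f k l = ∑ k ∈ range (T + 1), ∑ l ∈ range (T + 1), f k l := by
      have hin : ∀ k, ∑ l ∈ range (D + 1), f k l = ∑ l ∈ range (T + 1), f k l := by
        intro k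
        refine Finset.sum_subset hDT fun l _ hl => ?_
        have hl' : ¬ l ≤ D := fun h => hl (mem_range.mpr (by omega))
        simp only [hf, if_neg (fun h : k ≤ D ∧ l ≤ D => hl' h.2)]
      simp_rw [hin]
      refine Finset.sum_subset hDT fun k _ hk => ?_
      have hk' : ¬ k ≤ D := fun h => hk (mem_range.mpr (by omega))
      refine Finset.sum_eq_zero fun l _ => ?_
      simp only [hf, if_neg (fun h : k ≤ D ∧ l ≤ D => hk' h.1)]
    rw [h2]; exact h1
  -- (iii) assemble, using the symmetry of the square under `k ↔ l`
  have hsymm : ∑ k ∈ range (B + 1), ∑ l ∈ range (B + 1), f l k = ∑ k ∈ range (B + 1), ∑ l ∈ range (B + 1), f k l :=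
    Finset.sum_comm
  have hre : ∑ k ∈ range (B + 1), ∑ l ∈ range (B + 1), (f k l + f l k) / 2 = ∑ k ∈ range (B + 1), ∑ l ∈ range (B + 1), f k l := by
    have e : ∀ k l : ℕ, (f k l + f l k) / 2 = f k l / 2 + f l k / 2 := fun k l => by ring
    simp_rw [e, Finset.sum_add_distrib, ← Finset.sum_div]
    rw [hsymm]; ring
  calc ∑ k ∈ range (B + 1), ∑ l ∈ range (B + 1), ((1 : ℝ) + k + l) ^ r * |(if k ≤ G.degree ∧ l ≤ G.degree then (G.coeff k l + G.coeff l k) / 2 else 0)|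
      ≤ ∑ k ∈ range (B + 1), ∑ l ∈ range (B + 1), (f k l + f l k) / 2 :=
        Finset.sum_le_sum fun k _ => Finset.sum_le_sum fun l _ => hterm k l
    _ = ∑ k ∈ range (B + 1), ∑ l ∈ range (B + 1), f k l := hre
    _ ≤ G.coeffNorm r := hsq

/-- **THE JACKSON MEAN IS A COEFFICIENT-WEIGHT CONTRACTION ON FRAMES**: `coeffNorm r (jacksonFrame d G.eval) ≤ coeffNorm r G` for every
order `r` and every degree `d` (multipliers `ĵ_k ĵ_l ∈ [0,1]`; no `d`-loss). -/
theorem coeffNorm_jacksonFrame_eval_le (d : ℕ) (G : TrigPolyC4v) (r : ℕ) :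
    (jacksonFrame d G.eval).coeffNorm r ≤ G.coeffNorm r := by
  have hdeg : (jacksonFrame d G.eval).degree = d + d := rfl
  rw [TrigPolyC4v.coeffNorm, hdeg]
  calc ∑ k ∈ range (d + d + 1), ∑ l ∈ range (d + d + 1), (1 + k + l : ℝ) ^ r * |(jacksonFrame d G.eval).coeff k l|
      ≤ ∑ k ∈ range (d + d + 1), ∑ l ∈ range (d + d + 1),
          (1 + k + l : ℝ) ^ r * |(if k ≤ G.degree ∧ l ≤ G.degree then (G.coeff k l + G.coeff l k) / 2 else 0)| := by
        refine Finset.sum_le_sum fun k _ => Finset.sum_le_sum fun l _ => ?_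
        rw [jacksonFrame_eval_coeff, abs_mul]
        have hx := jhat_mul_jhat_mem d k l
        calc (1 + k + l : ℝ) ^ r * (|(jkerCoeff d k * cosNorm k) * (jkerCoeff d l * cosNorm l)| *
            |(if k ≤ G.degree ∧ l ≤ G.degree then (G.coeff k l + G.coeff l k) / 2 else 0)|)
            ≤ (1 + k + l : ℝ) ^ r * (1 * |(if k ≤ G.degree ∧ l ≤ G.degree then (G.coeff k l + G.coeff l k) / 2 else 0)|) := by
              gcongr
              rw [abs_of_nonneg hx.1]; exact hx.2
          _ = _ := by ring
    _ ≤ G.coeffNorm r := sum_weight_abs_symCoeff_le G r (d + d)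

/-! ## §4 The low part `jlow = 2𝒥 − 𝒥²` of a frame: coefficients and the weight contraction -/

/-- **Convolution theorem on frames**: the cosine moments of the Jackson mean of a frame are `ĵ_k ĵ_l` times those of the frame (inside degree
`2d`; the Jackson coefficients vanish beyond). -/
theorem cosMoment_jsmooth_trigPoly_eval (d : ℕ) (G : TrigPolyC4v) {k l : ℕ} (hk : k ≤ d + d) (hl : l ≤ d + d) :
    cosMoment (jsmooth d G.eval) k l = (jkerCoeff d k * cosNorm k) * (jkerCoeff d l * cosNorm l) * cosMoment G.eval k l := by
  have hG : Continuous G.eval := (TrigPolyC4v.contDiff_eval G (n := 0)).continuous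
  -- the Jackson mean of a frame IS the frame `jacksonFrame d G.eval`
  have hfun : jsmooth d G.eval = (jacksonFrame d G.eval).eval :=
    funext fun p => (eval_jacksonFrame hG (TrigPolyC4v.eval_periodic G) (TrigPolyC4v.eval_reflect G) (TrigPolyC4v.eval_swap G) d p).symm
  rw [hfun, cosMoment_trigPoly_eval, cosMoment_trigPoly_eval]
  -- the symmetrised coefficient of the Jackson frame
  have hdeg : (jacksonFrame d G.eval).degree = d + d := rfl
  rw [hdeg, if_pos ⟨hk, hl⟩, jacksonFrame_eval_coeff, jacksonFrame_eval_coeff, symCoeff_symm G k l]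
  ring

/-- **Coefficients of the low part of a frame**: `(jlowFrame d G)_{k,l} = x(2 − x)·κ̃_{k,l}` with `x = ĵ_k ĵ_l`. -/
theorem jlowFrame_eval_coeff (d : ℕ) (G : TrigPolyC4v) (k l : ℕ) :
    (jlowFrame d G.eval).coeff k l =
      ((jkerCoeff d k * cosNorm k) * (jkerCoeff d l * cosNorm l)) * (2 - (jkerCoeff d k * cosNorm k) * (jkerCoeff d l * cosNorm l)) *
        (if k ≤ G.degree ∧ l ≤ G.degree then (G.coeff k l + G.coeff l k) / 2 else 0) := by
  show jkerCoeff d k * jkerCoeff d l * (2 * cosMoment G.eval k l - cosMoment (jsmooth d G.eval) k l) = _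
  by_cases hk : k ≤ d + d
  · by_cases hl : l ≤ d + d
    · rw [cosMoment_jsmooth_trigPoly_eval d G hk hl, cosMoment_trigPoly_eval]
      ring
    · have h0 : jkerCoeff d l = 0 := jkerCoeff_eq_zero_of_lt d (by omega)
      rw [h0]; ring
  · have h0 : jkerCoeff d k = 0 := jkerCoeff_eq_zero_of_lt d (by omega)
    rw [h0]; ring

/-- `x(2 − x) ∈ [0, 1]` on `[0, 1]`. -/
theorem mul_two_sub_mem {x : ℝ} (h0 : 0 ≤ x) (h1 : x ≤ 1) : 0 ≤ x * (2 - x) ∧ x * (2 - x) ≤ 1 :=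
  ⟨mul_nonneg h0 (by linarith), by nlinarith [sq_nonneg (1 - x)]⟩

/-- **THE LOW PART IS A COEFFICIENT-WEIGHT CONTRACTION ON FRAMES**: `coeffNorm r (jlowFrame d G.eval) ≤ coeffNorm r G` for every order `r` and
every degree `d` — child 2's frame map does not increase any coefficient weight (Wiener norm `r = 0`, position-moment laws `r ≤ 2`, …), with
constant `1`. -/
theorem coeffNorm_jlowFrame_eval_le (d : ℕ) (G : TrigPolyC4v) (r : ℕ) :
    (jlowFrame d G.eval).coeffNorm r ≤ G.coeffNorm r := by
  rw [TrigPolyC4v.coeffNorm, jlowFrame_degree]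
  calc ∑ k ∈ range (d + d + 1), ∑ l ∈ range (d + d + 1), (1 + k + l : ℝ) ^ r * |(jlowFrame d G.eval).coeff k l|
      ≤ ∑ k ∈ range (d + d + 1), ∑ l ∈ range (d + d + 1),
          (1 + k + l : ℝ) ^ r * |(if k ≤ G.degree ∧ l ≤ G.degree then (G.coeff k l + G.coeff l k) / 2 else 0)| := by
        refine Finset.sum_le_sum fun k _ => Finset.sum_le_sum fun l _ => ?_
        rw [jlowFrame_eval_coeff, abs_mul]
        have hx := jhat_mul_jhat_mem d k l
        have hy := mul_two_sub_mem hx.1 hx.2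
        calc (1 + k + l : ℝ) ^ r *
              (|(jkerCoeff d k * cosNorm k) * (jkerCoeff d l * cosNorm l) * (2 - (jkerCoeff d k * cosNorm k) * (jkerCoeff d l * cosNorm l))| *
                |(if k ≤ G.degree ∧ l ≤ G.degree then (G.coeff k l + G.coeff l k) / 2 else 0)|)
            ≤ (1 + k + l : ℝ) ^ r * (1 * |(if k ≤ G.degree ∧ l ≤ G.degree then (G.coeff k l + G.coeff l k) / 2 else 0)|) := by
              gcongr
              rw [abs_of_nonneg hy.1]; exact hy.2
          _ = _ := by ring
    _ ≤ G.coeffNorm r := sum_weight_abs_symCoeff_le G r (d + d)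

/-- **Sup consequence** (for the record): `sup |jlowFrame d G| ≤ coeffNorm 0 G`. -/
theorem abs_eval_jlowFrame_le_coeffNorm (d : ℕ) (G : TrigPolyC4v) (p : Fin 2 → ℝ) :
    |(jlowFrame d G.eval).eval p| ≤ G.coeffNorm 0 :=
  (TrigPolyC4v.abs_eval_le_coeffNorm _ p).trans (coeffNorm_jlowFrame_eval_le d G 0)

end Summit.HubbardSuperconductivity.HubbardSuperconductivity.Theorems.KLRegimeSplit

end
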